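import Literature.MathematicalPhysics.StatisticalMechanics.HardSphereContactTheoremProofs
import HarnessLib

/-!
# The compressibility excess vanishes linearly at low density

Helper file (`--supports stmt-AtomisticToContinuum-9518`, line `hemisphere-affine-slaving`) for the
registered stub [Z] `stub_hsCompressibility_linear` of the crux `CollisionalTransferLocality`:
there are `η_Z > 0` and `K ≥ 0` with `|Z(η) − 1| ≤ K η` for `0 ≤ η ≤ η_Z`, where
`Z = hsCompressibility = 1 + η f_ex'(η)`.

Proof: below the cluster radius `σ₁ := min σ₀ (1/4)` of `HardSphereContactTheoremProofs`
(`exists_smallDensity`) the tree proves `HasDerivAt f_ex (Λ(σ³)) (σ³)` for `0 < σ < σ₁`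
(`hasDerivAt_hsExcessFreeEnergy`) with `Λ(t) = (v₁/2) g₂(1⁺; t^{1/3})` (`Lam`), `v₁ = 4π/3`
(`v₁_eq`) and `|g₂(1⁺; σ)| ≤ 9` (`abs_contactG_le`). Hence for `0 < η ≤ (σ₁/2)³`, with
`σ := η^{1/3} < σ₁`, `|Z(η) − 1| = η |Λ(η)| ≤ η · (2π/3) · 9 = 6π η`; at `η = 0` both sides
vanish. No dynamics, no probability here.
-/

namespace Summit.AtomisticToContinuum.HydrodynamicLimit.Theorems.HemisphereAffineSlaving

open scoped BigOperators Topology Classical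
open Filter Set Function

noncomputable section

open Literature.MathematicalPhysics.KineticTheory (hsExcessFreeEnergy hsCompressibility
  uniformProfile SmallDensity exists_smallDensity v₁)
open Literature.MathematicalPhysics.StatisticalMechanics (hasDerivAt_hsExcessFreeEnergy
  abs_contactG_le v₁_eq Lam contactG pow_three_rpow_third rpow_third_pow_three
  rpow_third_le_rpow_third)

/-- **[Z] The compressibility excess vanishes linearly at low density** (registered stub of the
crux `CollisionalTransferLocality`, stmt-AtomisticToContinuum-9518, line
hemisphere-affine-slaving): there are `η_Z > 0` and `K ≥ 0` with `|Z(η) − 1| ≤ K η` for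
`0 ≤ η ≤ η_Z`. With the cluster radius `σ₁` of the contact theorem, `η_Z := (σ₁/2)³` and
`K := 6π` work: for `0 < η ≤ η_Z`, `σ := η^{1/3} < σ₁`, so
`f_ex'(η) = Λ(η) = (v₁/2) g₂(1⁺; σ)` (`hasDerivAt_hsExcessFreeEnergy`), `v₁ = 4π/3` and
`|g₂(1⁺; σ)| ≤ 9` (`abs_contactG_le`), whence `|Z(η) − 1| = η |Λ(η)| ≤ 6π η`; at `η = 0`,
`Z(0) − 1 = 0`. [cite: HansenMcdonald2013, §2.5 (2.5.26)] -/
theorem stub_hsCompressibility_linear : ∃ ηZ : ℝ, 0 < ηZ ∧ ∃ K : ℝ, 0 ≤ K ∧ ∀ η : ℝ, 0 ≤ η → η ≤ ηZ → |Literature.MathematicalPhysics.KineticTheory.hsCompressibility η - 1| ≤ K * η := by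
  obtain ⟨σ₀, hσ₀, hsd0⟩ := exists_smallDensity uniformProfile one_pos
  set σ₁ := min σ₀ (1 / 4 : ℝ) with hσ₁
  have hsd : ∀ σ, 0 < σ → σ < σ₁ → SmallDensity uniformProfile σ := fun σ h0 h1 =>
    (hsd0 σ h0 (h1.trans_le (min_le_left _ _))).1
  have hσ₁4 : σ₁ ≤ 1 / 4 := min_le_right _ _
  have hσ₁0 : 0 < σ₁ := lt_min hσ₀ (by norm_num)
  refine ⟨(σ₁ / 2) ^ 3, by positivity, 6 * Real.pi, by positivity, fun η hη0 hη1 => ?_⟩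
  rcases hη0.eq_or_lt with h0 | hηpos
  · subst h0
    simp [Literature.MathematicalPhysics.KineticTheory.hsCompressibility]
  -- the reduced diameter `σ := η^{1/3}` lies below the cluster radius
  have hσpos : 0 < η ^ (1 / 3 : ℝ) := Real.rpow_pos_of_pos hηpos _
  have hσ3 : (η ^ (1 / 3 : ℝ)) ^ 3 = η := rpow_third_pow_three hη0
  have hσle : η ^ (1 / 3 : ℝ) ≤ σ₁ / 2 := by
    have h := rpow_third_le_rpow_third hη0 hη1
    rwa [pow_three_rpow_third (by positivity : (0 : ℝ) ≤ σ₁ / 2)] at h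
  have hσlt : η ^ (1 / 3 : ℝ) < σ₁ := by linarith
  -- `f_ex'(η) = Λ(η)` and `|g₂(1⁺; σ)| ≤ 9`
  have hD := hasDerivAt_hsExcessFreeEnergy hσ₁4 hsd hσpos hσlt
  rw [hσ3] at hD
  have hderiv : deriv hsExcessFreeEnergy η = Lam η := hD.deriv
  have hG : |contactG (η ^ (1 / 3 : ℝ))| ≤ 9 := abs_contactG_le (hsd _ hσpos hσlt)
  have hZ : hsCompressibility η - 1 = η * (v₁ / 2 * contactG (η ^ (1 / 3 : ℝ))) := by
    rw [Literature.MathematicalPhysics.KineticTheory.hsCompressibility, hderiv, Lam]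
    ring
  have hc0 : (0 : ℝ) ≤ 4 * Real.pi / 3 / 2 := by positivity
  rw [hZ, abs_mul, abs_of_nonneg hη0, v₁_eq, abs_mul, abs_of_nonneg hc0]
  calc η * (4 * Real.pi / 3 / 2 * |contactG (η ^ (1 / 3 : ℝ))|)
      ≤ η * (4 * Real.pi / 3 / 2 * 9) := by gcongr
    _ = 6 * Real.pi * η := by ring

end

end Summit.AtomisticToContinuum.HydrodynamicLimit.Theorems.HemisphereAffineSlaving
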